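import Summits.QuantumFields.YangMills.Theorems.FluctuationComparisonRegPrIntLOrganTangentSU2RightIncrements
import Summits.QuantumFields.YangMills.Theorems.FluctuationComparisonRegPrIntLOrganTangentNearStability
import Summits.QuantumFields.YangMills.Theorems.FluctuationComparisonRegPrIntLOrganTangentILawRegOfWeightLip
import Summits.QuantumFields.YangMills.Theorems.FluctuationComparisonRegPrIntLOrganTangentTopDisplacementLipOfHdisp
import HarnessLib

/-!
# Crux `FluctuationComparisonRegPrIntL` (stmt-QuantumFields-20520, rung R3), PATH-B organ — (L50b) «THE D0 CHART LETTERS OF THE WHITENED COVARIANT CHART» (RULING №56 (4), LEAD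
# w3 g28; ★★OWNER booked): `Dlink`∣MW and (J-Lip)∣MW — the two chart-side letters consumed by ✓`…OrganTangentILawRegOfBetaAndIncr` (`hPincr`∕`hSincr`, `hPJ`∕`hSJ`) — as
# FIRST-ORDER letters of `Φ_w(V,z) = A_V·exp(K_V^{−1∕2}z)`, stated ONCE in local two-point form with the two moduli SEPARATE ((Dmin) for `V ↦ A_V`, (Dwhite∣MW) for
# `V ↦ K_V^{−1∕2}z`), plus the PRODUCT door for the Jacobian; conclusions = the four consumer binder texts VERBATIM

Cell `ym3-torus` (YM ladder rung R3 = continuum `SU(2)` Yang–Mills on the three-torus — a RUNG: NOT d = 4, NOT infinite volume, NOT a mass gap, NOT Clay).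
Width seat `ym-ust-20520-w5` (gen 25), `--kind proof --supports stmt-QuantumFields-20520 --as helper`, count-neutral, DEFINITION-FREE, default heartbeats,
no registry ∕ binder ∕ `Lines/` edit.  Over ✓`…OrganTangentSU2RightIncrements` (L50a), ✓`…OrganTangentNearStability` (`plaqSmall_relPath_of_le`, `plaqSmall_relSquare_of_le`,
`guard8_of_guard16`, `plaqSmall_mono`, `abs_le_two_of_mem_Icc`), ✓`…OrganTangentILawRegOfWeightLip` (`abs_le_two_of_mem_Ioo`), ✓`…OrganTangentTopDisplacementLipOfHdisp`
(`lipschitzOnWith_of_local`).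

THE OBJECTS (abstract, no definitions): `Amin : G_j → G_Ts` (the minimiser section `V ↦ A_V`), `Wh : G_j → Z → PBond_Ts → ℝ³` (the whitened fluctuation `(V, z) ↦ K_V^{−1∕2}z`
read bondwise in exponential coordinates), tied to the organ's chart by the structure letter (Φw) «`Φ (V, z) e = Amin V e · expPt (Wh V z e)`»; for the Jacobian,
`cJ : G_j → ℝ` (the z-FREE factor `det K_V^{−1∕2}`·const) and `χ : G_j → Z → ℝ` (what does NOT cancel: the exponential-chart Haar density at `(K_V^{−1∕2}z)_e` and any
`V`-dependent `z`-window factor), tied by (Jfac) «`J (V, z) = cJ V · χ V z`».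

THE LETTERS (hypothesis texts; local two-point form: ONE coarse bond `b` of a `θ_j`-small field `V` moved by `expPt u`, `‖u‖_sup ≤ δ₀`, `V′ := update V b (V b·expPt u)` also
`θ_j`-small):
* (Dmin) «`∀ e, ∃ a, Amin V′ e = Amin V e·expPt a ∧ ‖a‖ ≤ kA e·‖u‖`» — z-FREE, no multiwindow premise: the minimiser's bondwise displacement under a one-bond move of the
  background — ANCHOR (px19 g23, first refusal): [Balaban1985Variational] Prop. 9 p.309 with (190) p.308, entry `n = 0`
  (`|δ𝓗_μ(B,x)∕δB_ν(y′)| ≤ O(1)(L^jη)^{−1}(L^{j′}η)^{−d}e^{−δ₀d(y,y′)∕8}`), read along the one-bond move by the mean-value theorem; tree (lit, kernel-checked):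
  ✓`B11Ineq190Actual.ineq190_sectG`, ✓`B11Response190OneBond.response190_localized_increment_sectG` (the INCREMENT from a base point for a block-localised source =
  exactly this two-point form), ✓`B11MeanValue190Chart`.
* (Dwhite∣MW) «multiwindow-good along the OPEN segment `r ∈ Ioo 0 1 ↦ Φ (update V b (V b·expPt (r•u)), z)` ⟹ `∀ e, ‖Wh V′ z e − Wh V z e‖ ≤ kW e·‖u‖`» — ADDITIVE; since
  `Wh V z = K_V^{−1∕2}z` is LINEAR in `z`, `Wh V′ z e − Wh V z e = Σ_{e′} (K_{V′}^{−1∕2} − K_V^{−1∕2})(e,e′)·z_{e′}`, so `kW e` is the `z`-window size times the ROW-SUM over `e′` of the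
  kernel `∂_B K_V^{−1∕2}(e,e′)`; its m-UNIFORMITY (decay of that row-sum in `dist(e,B)` uniformly in the IR cutoff `L^m`) is the content (LEAD №19's remark) — ANCHOR
  (px19 g23): print HAS the square-root kernel: [Balaban1988RG2] (CMP 116) (2.7) p.13, `(C^{(k)})^{1∕2} = (C*Δ_kC)^{−1∕2} = (1∕π)∫₀^∞ dx x^{−1∕2}(xI + C*Δ_kC)^{−1}`, the
  resolvent expanded by the generalized random walk of [Balaban1985BackgroundPropagators] (3.185) ∕ Thms 3.1–3.10 (p.15: «the general case is handled by a perturbative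
  argument»); tree (lit-balaban b13, kernel-checked): ✓`B13Sqrt27.invSqrt_apply_eq_integral` ((2.7), entrywise; the series term's missing `1∕π` is a refuted print slip,
  ✓`eq27_as_printed_false`), ✓`abs_invSqrt_apply_le_of_decay(_exp)` (the square root inherits HALF the resolvent's decay rate), ✓`B13GaugeDevices` §F (the square root is
  COVARIANT).  NOT displayed in print (honest gap): the BACKGROUND DERIVATIVE `∂_B K_V^{−1∕2}` itself — print-shaped as `(1∕π)∫₀^∞ x^{−1∕2}(x + K_V)^{−1}(∂_B K_V)(x + K_V)^{−1}dx`
  ((2.7) + the first resolvent identity = ✓`…OrganTangentResolventDoubleDifference`'s algebra one level down), with `∂_B K_V` LOCAL at `B` ([Balaban1987RG1] (1.5), p.261) and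
  both resolvents decaying x-uniformly ⟹ `Σ_{e′}|∂_B K_V^{−1∕2}(e,e′)| ≤ C·e^{−(κ∕2)·dist(e,B)}`.
* (cJ-bdd∕Lip) «`|cJ V| ≤ Cc`, `|cJ V′ − cJ V| ≤ Kc·‖u‖`» — z-free; in every NORMALISED weight and every score covariance `cJ` CANCELS (TN-WARD-SPLIT (vi)); REG′ being
  qualitative, its modulus is immaterial there too; typed only because the organ's `J` (the disintegration Jacobian of row-sq v0.4's chart clause) contains it.
* (χ-bdd∕Lip∣MW) «`|χ V z| ≤ Cχ`; under the open-segment multiwindow premise `|χ V′ z − χ V z| ≤ Kχ·‖u‖`» — THE ONLY J-LETTER THAT CARRIES CONTENT.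
  RULING №57 (LEAD w3 g28): its intended inhabitant is (i) `χ(V,z) = Π_e (σ∕σ₀)((K_V^{−1∕2}z)_e)` (the exponential-chart Haar density read through the whitening), with a
  `z`-dependent Lipschitz modulus allowed; `Kχ` is extensive in the fibre size; harmless — REG′ is qualitative (px19 g23's certificate: ✓`…OrganTangentHaarFactorLipOfDwhite`).
INHABITATION (★★OWNER RULING №100): all five letters are LAW-FREE statements about the chart objects `Amin, Wh, cJ, χ` pointwise in `z` (no integral, no law).

WHAT.  §0 [folklore] `mem_uIoo_of_between` (a point strictly between two points of `uIcc x y` lies in `uIoo x y`), `incr_norm_le` (the arithmetic of the composed modulus).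
§1 ★★★`dlinkPath_of_dmin_dwhite` — (Φw) + (Dmin) + (Dwhite∣MW) + guard `(1 + 16√3·rc)·(θ_j∕4) ≤ θ_j` + `√3·δ·rc·(θ_j∕4) ≤ δ₀` ⟹ ✓p823910's `hPincr` TEXT VERBATIM with
`k e := (π∕2)·√3·(√3·kA e + (π∕2)·√3·kW e)·(√3·(rc·(θ_j∕4)))` (one bond moves: ✓`relPath_step`; increments compose: ✓`exists_rightIncr_comp`; additive ⟹ multiplicative:
✓`exists_expPt_eq_expPt_mul`).  §2 ★★★`dlinkSquare_of_dmin_dwhite` — the same ⟹ `hSincr` VERBATIM (✓`relSquare_row_step`: the `B = B′` row is still ONE bond moved, by the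
`Ad`-rotated direction).  §3 ★★`jLipPath_of_factors` ∕ ★★`jLipSquare_of_factors` — (Jfac) + (cJ-bdd∕Lip) + (χ-bdd∕Lip∣MW) ⟹ `hPJ` ∕ `hSJ` VERBATIM with
`KJ := toNNReal ((Cc·Kχ + Cχ·Kc)·(√3·(rc·(θ_j∕4))))` (local two-point bound + ✓`lipschitzOnWith_of_local` on the convex set `Ioo (−1) 2 ∩ uIcc x y`).

HONEST FRAMING: doors from HYPOTHESIS letters to HYPOTHESIS-shaped consumer binders; (Dmin), (Dwhite∣MW), (χ-Lip∣MW) are D0's content (crux 19200 EX ∧ V2′ for the whitened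
covariant chart) and are NOT proved here; nothing of Bałaban's analysis is asserted or proved; rows UNDISCHARGED; the five registered stubs of `Lines/semiclassical_s2beta.lean`,
crux 20520 and `YM3TorusSU2` are NOT proved; registry untouched; rung R3 = SU(2) YM₃ on T³ — NOT d = 4, NOT infinite volume, NOT a mass gap, NOT Clay; the Yang–Mills
mass gap is NOT proved.  [folklore]
-/

set_option autoImplicit false

noncomputable section

namespace Summit.QuantumFields.YangMills.Theorems.OrganTangentD0ChartLettersWhitened

open Function Set
open scoped NNReal
open Literature.MathematicalPhysics.QuantumFieldTheory
open Literature.MathematicalPhysics.QuantumFieldTheory.Balaban1983to89 T3ContinuumYM3Torus T3NestedUnitLaws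
  T3UnitLawDensityEML T4Continuum BalabanUVClass T3UnitScaleTilt T3LevelShift T3TiltDescent
open T4CubeChartGnomonic (SU2)
open T4CubeChartExp (expPt expPt_zero)
open Summit.QuantumFields.YangMills.Theorems.OrganTangentSU2RightIncrements (exists_expPt_eq_expPt_mul exists_rightIncr_comp relPath_step relSquare_row_step)
open Summit.QuantumFields.YangMills.Theorems.OrganTangentILawKnitFacts (plaqSmall_mono abs_le_two_of_mem_Icc)
open Summit.QuantumFields.YangMills.Theorems.OrganTangentRelPathWindow (plaqSmall_relPath_of_le plaqSmall_relSquare_of_le)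
open Summit.QuantumFields.YangMills.Theorems.OrganTangentNearStability (guard8_of_guard16)
open Summit.QuantumFields.YangMills.Theorems.OrganTangentILawRegOfWeightLip (abs_le_two_of_mem_Ioo)
open Summit.QuantumFields.YangMills.Theorems.OrganTangentTopDisplacementLipOfHdisp (lipschitzOnWith_of_local)

/-! ## §0 Folklore -/

/-- A point strictly between two DISTINCT points of `uIcc x y` lies in `uIoo x y`. [folklore] -/
theorem mem_uIoo_of_between {x y s s' r : ℝ} (hs : s ∈ uIcc x y) (hs' : s' ∈ uIcc x y) (hne : s ≠ s') (hr : r ∈ Ioo (0:ℝ) 1) :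
    s + r * (s' - s) ∈ uIoo x y := by
  change x ⊓ y ≤ s ∧ s ≤ x ⊔ y at hs
  change x ⊓ y ≤ s' ∧ s' ≤ x ⊔ y at hs'
  show s + r * (s' - s) ∈ Ioo (x ⊓ y) (x ⊔ y)
  rcases lt_or_gt_of_ne hne with h | h
  · have h1 : 0 < r * (s' - s) := mul_pos hr.1 (sub_pos.2 h)
    have h2 : r * (s' - s) < s' - s := by nlinarith [hr.2, sub_pos.2 h]
    exact ⟨by linarith [hs.1], by linarith [hs'.2]⟩
  · have h1 : r * (s' - s) < 0 := mul_neg_of_pos_of_neg hr.1 (sub_neg.2 h)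
    have h2 : s' - s < r * (s' - s) := by nlinarith [hr.2, sub_neg.2 h]
    exact ⟨by linarith [hs'.1], by linarith [hs.2]⟩

/-- The arithmetic of the composed modulus: `‖a‖ ≤ kA·ν`, `‖c‖ ≤ (π∕2)·(√3·(kW·ν))`, `ν ≤ σ·d` ⟹ `(π∕2)·(√3·(√3‖a‖ + ‖c‖)) ≤ ((π∕2)·√3·(√3·kA + (π∕2)·√3·kW)·σ)·d`. [folklore] -/
theorem incr_norm_le {na nc kA kW ν σ d : ℝ} (hkA : 0 ≤ kA) (hkW : 0 ≤ kW)
    (ha : na ≤ kA * ν) (hc : nc ≤ Real.pi / 2 * (Real.sqrt 3 * (kW * ν))) (hν : ν ≤ σ * d) :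
    Real.pi / 2 * (Real.sqrt 3 * (Real.sqrt 3 * na + nc)) ≤ (Real.pi / 2 * Real.sqrt 3 * (Real.sqrt 3 * kA + Real.pi / 2 * Real.sqrt 3 * kW) * σ) * d := by
  have hπ : 0 ≤ Real.pi / 2 := by positivity
  have h3 : 0 ≤ Real.sqrt 3 := Real.sqrt_nonneg 3
  have hν' : kA * ν ≤ kA * (σ * d) := mul_le_mul_of_nonneg_left hν hkA
  have hν'' : kW * ν ≤ kW * (σ * d) := mul_le_mul_of_nonneg_left hν hkW
  have h1 : Real.sqrt 3 * na + nc ≤ Real.sqrt 3 * (kA * (σ * d)) + Real.pi / 2 * (Real.sqrt 3 * (kW * (σ * d))) :=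
    add_le_add (mul_le_mul_of_nonneg_left (ha.trans hν') h3) (hc.trans (mul_le_mul_of_nonneg_left (mul_le_mul_of_nonneg_left hν'' h3) hπ))
  calc Real.pi / 2 * (Real.sqrt 3 * (Real.sqrt 3 * na + nc))
      ≤ Real.pi / 2 * (Real.sqrt 3 * (Real.sqrt 3 * (kA * (σ * d)) + Real.pi / 2 * (Real.sqrt 3 * (kW * (σ * d))))) :=
        mul_le_mul_of_nonneg_left (mul_le_mul_of_nonneg_left h1 h3) hπ
    _ = (Real.pi / 2 * Real.sqrt 3 * (Real.sqrt 3 * kA + Real.pi / 2 * Real.sqrt 3 * kW) * σ) * d := by ring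

/-! ## §1 `Dlink`∣MW along relational PATHS: ✓p823910's `hPincr` text -/

section Letters

/-- ★★★ **(Φw) + (Dmin) + (Dwhite∣MW) ⟹ `Dlink`∣MW ALONG NEAR RELATIONAL PATHS** — the `hPincr` binder text of ✓`ilawRegX∕V3∕Sq_of_beta_of_incr` VERBATIM with
`k e := (π∕2)·√3·(√3·kA e + (π∕2)·√3·kW e)·(√3·(rc·(θ_j∕4)))`. [folklore] -/
theorem dlinkPath_of_dmin_dwhite (F : T3Family) (γ b₀ p₀ : ℝ) (j Ts : ℕ) {Z : Type}
    (Φ : GaugeField (F.P j) 0 ↥(Matrix.specialUnitaryGroup (Fin 2) ℂ) × Z → GaugeField (F.P Ts) 0 ↥(Matrix.specialUnitaryGroup (Fin 2) ℂ)) (Amin : GaugeField (F.P j) 0 ↥(Matrix.specialUnitaryGroup (Fin 2) ℂ) → GaugeField (F.P Ts) 0 ↥(Matrix.specialUnitaryGroup (Fin 2) ℂ)) (Wh : GaugeField (F.P j) 0 ↥(Matrix.specialUnitaryGroup (Fin 2) ℂ) → Z → PBond (F.P Ts) 0 → (Fin 3 → ℝ))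
    (hΦw : ∀ V z e, Φ (V, z) e = Amin V e * expPt (Wh V z e))
    (rc δ δ₀ : ℝ) (hrc : 0 ≤ rc) (hθj : 0 < θBal F.L γ b₀ p₀ j) (hguard : (1 + 16 * Real.sqrt 3 * rc) * (θBal F.L γ b₀ p₀ j / 4) ≤ θBal F.L γ b₀ p₀ j)
    (hδ₀ : Real.sqrt 3 * (δ * (rc * (θBal F.L γ b₀ p₀ j / 4))) ≤ δ₀)
    (kA kW : PBond (F.P Ts) 0 → ℝ) (hkA0 : ∀ e, 0 ≤ kA e) (hkW0 : ∀ e, 0 ≤ kW e)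
    -- (Dmin): the minimiser's bondwise displacement under a one-bond coarse move (z-free)
    (hDmin : ∀ (V : GaugeField (F.P j) 0 ↥(Matrix.specialUnitaryGroup (Fin 2) ℂ)) (b : PBond (F.P j) 0) (u : Fin 3 → ℝ), PlaqSmall (θBal F.L γ b₀ p₀ j) V →
      PlaqSmall (θBal F.L γ b₀ p₀ j) (update V b (V b * expPt u)) → ‖u‖ ≤ δ₀ →
      ∀ e, ∃ a : Fin 3 → ℝ, Amin (update V b (V b * expPt u)) e = Amin V e * expPt a ∧ ‖a‖ ≤ kA e * ‖u‖)
    -- (Dwhite∣MW): the whitened fluctuation's bondwise ADDITIVE increment under the same move, on the multiwindow-good open segment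
    (hDwhite : ∀ (z : Z) (V : GaugeField (F.P j) 0 ↥(Matrix.specialUnitaryGroup (Fin 2) ℂ)) (b : PBond (F.P j) 0) (u : Fin 3 → ℝ), PlaqSmall (θBal F.L γ b₀ p₀ j) V →
      PlaqSmall (θBal F.L γ b₀ p₀ j) (update V b (V b * expPt u)) → ‖u‖ ≤ δ₀ →
      (∀ r ∈ Set.Ioo (0:ℝ) 1, ∀ (n : ℕ) (hjn : j + 1 ≤ n) (hnK : n ≤ Ts), PlaqSmall (24 / 25 * θBal F.L γ b₀ p₀ n) (descendTo F ℰp n Ts hnK (Φ (update V b (V b * expPt (r • u)), z)))) →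
      ∀ e, ‖Wh (update V b (V b * expPt u)) z e - Wh V z e‖ ≤ kW e * ‖u‖) :
    ∀ (B' : PBond (F.P j) 0) (m' : Fin 3 → ℝ) (U₂ : GaugeField (F.P j) 0 ↥(Matrix.specialUnitaryGroup (Fin 2) ℂ))
      (X : ℝ → GaugeField (F.P j) 0 ↥(Matrix.specialUnitaryGroup (Fin 2) ℂ)), ‖m'‖ ≤ rc * (θBal F.L γ b₀ p₀ j / 4) → PlaqSmall (θBal F.L γ b₀ p₀ j / 4) U₂ →
      (∀ s e, e ≠ B' → X s e = U₂ e) → (∀ s, X s B' = U₂ B' * expPt (s • m')) → ∀ (z : Z), ∀ x ∈ Set.Ioo (-1 : ℝ) 2, ∀ y ∈ Set.Ioo (-1 : ℝ) 2,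
        (∀ r ∈ Set.uIoo x y, ∀ (n : ℕ) (hjn : j + 1 ≤ n) (hnK : n ≤ Ts), PlaqSmall (24 / 25 * θBal F.L γ b₀ p₀ n) (descendTo F ℰp n Ts hnK (Φ (X r, z)))) →
        ∀ s ∈ Set.Ioo (-1 : ℝ) 2 ∩ Set.uIcc x y, ∀ s' ∈ Set.Ioo (-1 : ℝ) 2 ∩ Set.uIcc x y, |s - s'| ≤ δ →
          ∀ e, ∃ w : Fin 3 → ℝ, Φ (X s', z) e = Φ (X s, z) e * expPt w ∧ ‖w‖ ≤ Real.pi / 2 * Real.sqrt 3 * (Real.sqrt 3 * kA e + Real.pi / 2 * Real.sqrt 3 * kW e) * (Real.sqrt 3 * (rc * (θBal F.L γ b₀ p₀ j / 4))) * |s - s'| := by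
  intro B' m' U₂ X hm' hU₂ hoff hon z x hx y hy hgood s hs s' hs' hδ e
  by_cases hss : s = s'
  · subst hss
    exact ⟨0, by rw [expPt_zero, mul_one], by rw [norm_zero, sub_self, abs_zero, mul_zero]⟩
  obtain ⟨-, -, hu, hupd⟩ := relPath_step B' m' U₂ X hoff hon s s'
  have hXs' : X s' = update (X s) B' (X s B' * expPt ((s' - s) • m')) := by
    have h := hupd 1; rw [one_smul, one_mul, add_sub_cancel] at h; exact h.symm
  -- both path points are `θ_j`-small
  have h8 := guard8_of_guard16 hrc hθj.le hguard
  have hVs : ∀ σ ∈ Set.Ioo (-1:ℝ) 2, PlaqSmall (θBal F.L γ b₀ p₀ j) (X σ) :=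
    fun σ hσ => plaqSmall_mono h8 (plaqSmall_relPath_of_le hU₂ hm' hoff hon (abs_le_two_of_mem_Ioo hσ))
  have hV := hVs s hs.1
  have hV' := hVs s' hs'.1
  rw [hXs'] at hV'
  -- the size of the coarse step
  have hnu : ‖(s' - s) • m'‖ ≤ Real.sqrt 3 * (rc * (θBal F.L γ b₀ p₀ j / 4)) * |s - s'| := by
    calc ‖(s' - s) • m'‖ ≤ Real.sqrt 3 * (|s' - s| * ‖m'‖) := hu
      _ ≤ Real.sqrt 3 * (|s' - s| * (rc * (θBal F.L γ b₀ p₀ j / 4))) :=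
          mul_le_mul_of_nonneg_left (mul_le_mul_of_nonneg_left hm' (abs_nonneg _)) (Real.sqrt_nonneg 3)
      _ = Real.sqrt 3 * (rc * (θBal F.L γ b₀ p₀ j / 4)) * |s - s'| := by rw [abs_sub_comm]; ring
  have hδ' : ‖(s' - s) • m'‖ ≤ δ₀ := by
    refine hnu.trans (le_trans ?_ hδ₀)
    have hθ4 : 0 ≤ Real.sqrt 3 * (rc * (θBal F.L γ b₀ p₀ j / 4)) := by positivity
    calc Real.sqrt 3 * (rc * (θBal F.L γ b₀ p₀ j / 4)) * |s - s'| ≤ Real.sqrt 3 * (rc * (θBal F.L γ b₀ p₀ j / 4)) * δ := mul_le_mul_of_nonneg_left hδ hθ4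
      _ = Real.sqrt 3 * (δ * (rc * (θBal F.L γ b₀ p₀ j / 4))) := by ring
  -- the multiwindow premise along the open segment between the two path points
  have hseg : ∀ r ∈ Set.Ioo (0:ℝ) 1, ∀ (n : ℕ) (hjn : j + 1 ≤ n) (hnK : n ≤ Ts), PlaqSmall (24 / 25 * θBal F.L γ b₀ p₀ n) (descendTo F ℰp n Ts hnK (Φ (update (X s) B' (X s B' * expPt (r • ((s' - s) • m'))), z))) := by
    intro r hr; rw [hupd r]; exact hgood _ (mem_uIoo_of_between hs.2 hs'.2 hss hr)
  obtain ⟨a, ha, hale⟩ := hDmin (X s) B' ((s' - s) • m') hV hV' hδ' e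
  have hwh := hDwhite z (X s) B' ((s' - s) • m') hV hV' hδ' hseg e
  obtain ⟨c, hc, hcle⟩ := exists_expPt_eq_expPt_mul (Wh (X s) z e) (Wh (update (X s) B' (X s B' * expPt ((s' - s) • m'))) z e)
  obtain ⟨w, hw, hwle⟩ := exists_rightIncr_comp (Amin (X s) e) (Amin (update (X s) B' (X s B' * expPt ((s' - s) • m'))) e)
    (Wh (X s) z e) (Wh (update (X s) B' (X s B' * expPt ((s' - s) • m'))) z e) a c ha hc
  refine ⟨w, ?_, hwle.trans (incr_norm_le (hkA0 e) (hkW0 e) hale ?_ hnu)⟩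
  · rw [hΦw, hΦw, hXs']; exact hw
  · exact hcle.trans (mul_le_mul_of_nonneg_left (mul_le_mul_of_nonneg_left hwh (Real.sqrt_nonneg 3)) (by positivity))

end Letters

/-! ## §2 `Dlink`∣MW along the ROWS of relational SQUARES: ✓p823910's `hSincr` text -/

section LettersSq

/-- ★★★ **(Φw) + (Dmin) + (Dwhite∣MW) ⟹ `Dlink`∣MW ALONG THE ROWS OF NEAR RELATIONAL SQUARES** — the `hSincr` binder text VERBATIM, same `k` (✓`relSquare_row_step`: a row is ONE
bond moved, by an `Ad`-rotated direction when `B = B′`). [folklore] -/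
theorem dlinkSquare_of_dmin_dwhite (F : T3Family) (γ b₀ p₀ : ℝ) (j Ts : ℕ) {Z : Type}
    (Φ : GaugeField (F.P j) 0 ↥(Matrix.specialUnitaryGroup (Fin 2) ℂ) × Z → GaugeField (F.P Ts) 0 ↥(Matrix.specialUnitaryGroup (Fin 2) ℂ)) (Amin : GaugeField (F.P j) 0 ↥(Matrix.specialUnitaryGroup (Fin 2) ℂ) → GaugeField (F.P Ts) 0 ↥(Matrix.specialUnitaryGroup (Fin 2) ℂ)) (Wh : GaugeField (F.P j) 0 ↥(Matrix.specialUnitaryGroup (Fin 2) ℂ) → Z → PBond (F.P Ts) 0 → (Fin 3 → ℝ))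
    (hΦw : ∀ V z e, Φ (V, z) e = Amin V e * expPt (Wh V z e))
    (rc δ δ₀ : ℝ) (hrc : 0 ≤ rc) (hθj : 0 < θBal F.L γ b₀ p₀ j) (hguard : (1 + 16 * Real.sqrt 3 * rc) * (θBal F.L γ b₀ p₀ j / 4) ≤ θBal F.L γ b₀ p₀ j)
    (hδ₀ : Real.sqrt 3 * (δ * (rc * (θBal F.L γ b₀ p₀ j / 4))) ≤ δ₀)
    (kA kW : PBond (F.P Ts) 0 → ℝ) (hkA0 : ∀ e, 0 ≤ kA e) (hkW0 : ∀ e, 0 ≤ kW e)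
    -- (Dmin): the minimiser's bondwise displacement under a one-bond coarse move (z-free)
    (hDmin : ∀ (V : GaugeField (F.P j) 0 ↥(Matrix.specialUnitaryGroup (Fin 2) ℂ)) (b : PBond (F.P j) 0) (u : Fin 3 → ℝ), PlaqSmall (θBal F.L γ b₀ p₀ j) V →
      PlaqSmall (θBal F.L γ b₀ p₀ j) (update V b (V b * expPt u)) → ‖u‖ ≤ δ₀ →
      ∀ e, ∃ a : Fin 3 → ℝ, Amin (update V b (V b * expPt u)) e = Amin V e * expPt a ∧ ‖a‖ ≤ kA e * ‖u‖)
    -- (Dwhite∣MW): the whitened fluctuation's bondwise ADDITIVE increment under the same move, on the multiwindow-good open segment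
    (hDwhite : ∀ (z : Z) (V : GaugeField (F.P j) 0 ↥(Matrix.specialUnitaryGroup (Fin 2) ℂ)) (b : PBond (F.P j) 0) (u : Fin 3 → ℝ), PlaqSmall (θBal F.L γ b₀ p₀ j) V →
      PlaqSmall (θBal F.L γ b₀ p₀ j) (update V b (V b * expPt u)) → ‖u‖ ≤ δ₀ →
      (∀ r ∈ Set.Ioo (0:ℝ) 1, ∀ (n : ℕ) (hjn : j + 1 ≤ n) (hnK : n ≤ Ts), PlaqSmall (24 / 25 * θBal F.L γ b₀ p₀ n) (descendTo F ℰp n Ts hnK (Φ (update V b (V b * expPt (r • u)), z)))) →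
      ∀ e, ‖Wh (update V b (V b * expPt u)) z e - Wh V z e‖ ≤ kW e * ‖u‖) :
    ∀ (B B' : PBond (F.P j) 0) (m m' : Fin 3 → ℝ) (V00 : GaugeField (F.P j) 0 ↥(Matrix.specialUnitaryGroup (Fin 2) ℂ))
      (Y : ℝ → GaugeField (F.P j) 0 ↥(Matrix.specialUnitaryGroup (Fin 2) ℂ)) (X : ℝ → ℝ → GaugeField (F.P j) 0 ↥(Matrix.specialUnitaryGroup (Fin 2) ℂ)),
      ‖m‖ ≤ rc * (θBal F.L γ b₀ p₀ j / 4) → ‖m'‖ ≤ rc * (θBal F.L γ b₀ p₀ j / 4) → PlaqSmall (θBal F.L γ b₀ p₀ j / 4) V00 →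
      (∀ s e, e ≠ B → Y s e = V00 e) → (∀ s, Y s B = V00 B * expPt (s • m)) → (∀ s s' e, e ≠ B' → X s s' e = Y s e) → (∀ s s', X s s' B' = Y s B' * expPt (s' • m')) →
      ∀ s' ∈ Set.Icc (0:ℝ) 1, ∀ (z : Z), ∀ x ∈ Set.Ioo (-1 : ℝ) 2, ∀ y ∈ Set.Ioo (-1 : ℝ) 2,
        (∀ r ∈ Set.uIoo x y, ∀ (n : ℕ) (hjn : j + 1 ≤ n) (hnK : n ≤ Ts), PlaqSmall (24 / 25 * θBal F.L γ b₀ p₀ n) (descendTo F ℰp n Ts hnK (Φ (X r s', z)))) →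
        ∀ s ∈ Set.Ioo (-1 : ℝ) 2 ∩ Set.uIcc x y, ∀ s'' ∈ Set.Ioo (-1 : ℝ) 2 ∩ Set.uIcc x y, |s - s''| ≤ δ →
          ∀ e, ∃ w : Fin 3 → ℝ, Φ (X s'' s', z) e = Φ (X s s', z) e * expPt w ∧ ‖w‖ ≤ Real.pi / 2 * Real.sqrt 3 * (Real.sqrt 3 * kA e + Real.pi / 2 * Real.sqrt 3 * kW e) * (Real.sqrt 3 * (rc * (θBal F.L γ b₀ p₀ j / 4))) * |s - s''| := by
  intro B B' m m' V00 Y X hm hm' hV00 hYoff hYon hXoff hXon s' hs' z x hx y hy hgood s hs s'' hs'' hδ e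
  by_cases hss : s = s''
  · subst hss
    exact ⟨0, by rw [expPt_zero, mul_one], by rw [norm_zero, sub_self, abs_zero, mul_zero]⟩
  obtain ⟨u, -, -, hu, hupd⟩ := relSquare_row_step B B' m m' V00 Y X hYoff hYon hXoff hXon s s'' s'
  have hXs' : X s'' s' = update (X s s') B (X s s' B * expPt u) := by
    have h := hupd 1; rw [one_smul, one_mul, add_sub_cancel] at h; exact h.symm
  have hVs : ∀ σ ∈ Set.Ioo (-1:ℝ) 2, PlaqSmall (θBal F.L γ b₀ p₀ j) (X σ s') :=
    fun σ hσ => plaqSmall_mono hguard (plaqSmall_relSquare_of_le hV00 hm hm' hYoff hYon hXoff hXon (abs_le_two_of_mem_Ioo hσ) (abs_le_two_of_mem_Icc hs'))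
  have hV := hVs s hs.1
  have hV' := hVs s'' hs''.1
  rw [hXs'] at hV'
  have hnu : ‖u‖ ≤ Real.sqrt 3 * (rc * (θBal F.L γ b₀ p₀ j / 4)) * |s - s''| := by
    calc ‖u‖ ≤ Real.sqrt 3 * (|s'' - s| * ‖m‖) := hu
      _ ≤ Real.sqrt 3 * (|s'' - s| * (rc * (θBal F.L γ b₀ p₀ j / 4))) :=
          mul_le_mul_of_nonneg_left (mul_le_mul_of_nonneg_left hm (abs_nonneg _)) (Real.sqrt_nonneg 3)
      _ = Real.sqrt 3 * (rc * (θBal F.L γ b₀ p₀ j / 4)) * |s - s''| := by rw [abs_sub_comm]; ring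
  have hδ' : ‖u‖ ≤ δ₀ := by
    refine hnu.trans (le_trans ?_ hδ₀)
    have hθ4 : 0 ≤ Real.sqrt 3 * (rc * (θBal F.L γ b₀ p₀ j / 4)) := by positivity
    calc Real.sqrt 3 * (rc * (θBal F.L γ b₀ p₀ j / 4)) * |s - s''| ≤ Real.sqrt 3 * (rc * (θBal F.L γ b₀ p₀ j / 4)) * δ := mul_le_mul_of_nonneg_left hδ hθ4
      _ = Real.sqrt 3 * (δ * (rc * (θBal F.L γ b₀ p₀ j / 4))) := by ring
  have hseg : ∀ r ∈ Set.Ioo (0:ℝ) 1, ∀ (n : ℕ) (hjn : j + 1 ≤ n) (hnK : n ≤ Ts), PlaqSmall (24 / 25 * θBal F.L γ b₀ p₀ n) (descendTo F ℰp n Ts hnK (Φ (update (X s s') B (X s s' B * expPt (r • u)), z))) := by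
    intro r hr; rw [hupd r]; exact hgood _ (mem_uIoo_of_between hs.2 hs''.2 hss hr)
  obtain ⟨a, ha, hale⟩ := hDmin (X s s') B u hV hV' hδ' e
  have hwh := hDwhite z (X s s') B u hV hV' hδ' hseg e
  obtain ⟨c, hc, hcle⟩ := exists_expPt_eq_expPt_mul (Wh (X s s') z e) (Wh (update (X s s') B (X s s' B * expPt u)) z e)
  obtain ⟨w, hw, hwle⟩ := exists_rightIncr_comp (Amin (X s s') e) (Amin (update (X s s') B (X s s' B * expPt u)) e)
    (Wh (X s s') z e) (Wh (update (X s s') B (X s s' B * expPt u)) z e) a c ha hc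
  refine ⟨w, ?_, hwle.trans (incr_norm_le (hkA0 e) (hkW0 e) hale ?_ hnu)⟩
  · rw [hΦw, hΦw, hXs']; exact hw
  · exact hcle.trans (mul_le_mul_of_nonneg_left (mul_le_mul_of_nonneg_left hwh (Real.sqrt_nonneg 3)) (by positivity))

end LettersSq

/-! ## §3 (J-Lip)∣MW from the PRODUCT structure of the Jacobian: ✓p823910's `hPJ` ∕ `hSJ` texts -/

section Jacobian

/-- `|c₂χ₂ − c₁χ₁| ≤ |c₂|·|χ₂ − χ₁| + |χ₁|·|c₂ − c₁|`. [folklore] -/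
theorem abs_mul_sub_mul_le' (c₁ c₂ χ₁ χ₂ : ℝ) : |c₂ * χ₂ - c₁ * χ₁| ≤ |c₂| * |χ₂ - χ₁| + |χ₁| * |c₂ - c₁| := by
  rw [show c₂ * χ₂ - c₁ * χ₁ = c₂ * (χ₂ - χ₁) + χ₁ * (c₂ - c₁) by ring]
  exact (abs_add_le _ _).trans (by rw [abs_mul, abs_mul])

/-- The diameter bookkeeping: points of `Ioo (−1) 2` are within `(⌈3∕δ⌉₊ + 1)·δ` of each other. [folklore] -/
theorem abs_sub_le_ceil_mul {δ : ℝ} (hδ : 0 < δ) {a b : ℝ} (ha : a ∈ Set.Ioo (-1:ℝ) 2) (hb : b ∈ Set.Ioo (-1:ℝ) 2) :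
    |a - b| ≤ ((⌈3 / δ⌉₊ + 1 : ℕ) : ℝ) * δ := by
  have h3 : |a - b| ≤ 3 := abs_le.2 ⟨by linarith [ha.1, hb.2], by linarith [ha.2, hb.1]⟩
  have hc : 3 / δ ≤ (⌈3 / δ⌉₊ : ℝ) := Nat.le_ceil _
  have h1 : 3 ≤ ((⌈3 / δ⌉₊ + 1 : ℕ) : ℝ) * δ := by
    rw [Nat.cast_add, Nat.cast_one]
    have : 3 = 3 / δ * δ := by field_simp
    nlinarith
  exact h3.trans h1

/-- ★★ **(Jfac) + (cJ-bdd∕Lip) + (χ-bdd∕Lip∣MW) ⟹ (J-Lip)∣MW ALONG NEAR RELATIONAL PATHS** — the `hPJ` binder text VERBATIM with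
`KJ := toNNReal ((Cc·Kχ + Cχ·Kc)·(√3·(rc·(θ_j∕4))))`. [folklore] -/
theorem jLipPath_of_factors (F : T3Family) (γ b₀ p₀ : ℝ) (j Ts : ℕ) {Z : Type}
    (Φ : GaugeField (F.P j) 0 ↥(Matrix.specialUnitaryGroup (Fin 2) ℂ) × Z → GaugeField (F.P Ts) 0 ↥(Matrix.specialUnitaryGroup (Fin 2) ℂ)) (J : GaugeField (F.P j) 0 ↥(Matrix.specialUnitaryGroup (Fin 2) ℂ) × Z → ℝ≥0) (cJ : GaugeField (F.P j) 0 ↥(Matrix.specialUnitaryGroup (Fin 2) ℂ) → ℝ) (χ : GaugeField (F.P j) 0 ↥(Matrix.specialUnitaryGroup (Fin 2) ℂ) → Z → ℝ)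
    (hJfac : ∀ V z, (J (V, z) : ℝ) = cJ V * χ V z)
    (rc δ δ₀ : ℝ) (hrc : 0 ≤ rc) (hδpos : 0 < δ) (hθj : 0 < θBal F.L γ b₀ p₀ j) (hguard : (1 + 16 * Real.sqrt 3 * rc) * (θBal F.L γ b₀ p₀ j / 4) ≤ θBal F.L γ b₀ p₀ j)
    (hδ₀ : Real.sqrt 3 * (δ * (rc * (θBal F.L γ b₀ p₀ j / 4))) ≤ δ₀)
    (Cc Kc Cχ Kχ : ℝ) (hCc : 0 ≤ Cc) (hKc : 0 ≤ Kc) (hCχ : 0 ≤ Cχ) (hKχ : 0 ≤ Kχ)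
    -- (cJ-bdd∕Lip): the z-FREE factor (cancels in every normalised weight; typed only because the organ's `J` contains it)
    (hcbdd : ∀ V : GaugeField (F.P j) 0 ↥(Matrix.specialUnitaryGroup (Fin 2) ℂ), PlaqSmall (θBal F.L γ b₀ p₀ j) V → |cJ V| ≤ Cc)
    (hcLip : ∀ (V : GaugeField (F.P j) 0 ↥(Matrix.specialUnitaryGroup (Fin 2) ℂ)) (b : PBond (F.P j) 0) (u : Fin 3 → ℝ), PlaqSmall (θBal F.L γ b₀ p₀ j) V →
      PlaqSmall (θBal F.L γ b₀ p₀ j) (update V b (V b * expPt u)) → ‖u‖ ≤ δ₀ → |cJ (update V b (V b * expPt u)) - cJ V| ≤ Kc * ‖u‖)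
    -- (χ-bdd∕Lip∣MW): the factor that does NOT cancel — THE ONLY J-LETTER WITH CONTENT
    (hχbdd : ∀ (V : GaugeField (F.P j) 0 ↥(Matrix.specialUnitaryGroup (Fin 2) ℂ)) (z : Z), PlaqSmall (θBal F.L γ b₀ p₀ j) V → |χ V z| ≤ Cχ)
    (hχLip : ∀ (z : Z) (V : GaugeField (F.P j) 0 ↥(Matrix.specialUnitaryGroup (Fin 2) ℂ)) (b : PBond (F.P j) 0) (u : Fin 3 → ℝ), PlaqSmall (θBal F.L γ b₀ p₀ j) V →
      PlaqSmall (θBal F.L γ b₀ p₀ j) (update V b (V b * expPt u)) → ‖u‖ ≤ δ₀ →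
      (∀ r ∈ Set.Ioo (0:ℝ) 1, ∀ (n : ℕ) (hjn : j + 1 ≤ n) (hnK : n ≤ Ts), PlaqSmall (24 / 25 * θBal F.L γ b₀ p₀ n) (descendTo F ℰp n Ts hnK (Φ (update V b (V b * expPt (r • u)), z)))) →
      |χ (update V b (V b * expPt u)) z - χ V z| ≤ Kχ * ‖u‖) :
    ∀ (B' : PBond (F.P j) 0) (m' : Fin 3 → ℝ) (U₂ : GaugeField (F.P j) 0 ↥(Matrix.specialUnitaryGroup (Fin 2) ℂ))
      (X : ℝ → GaugeField (F.P j) 0 ↥(Matrix.specialUnitaryGroup (Fin 2) ℂ)), ‖m'‖ ≤ rc * (θBal F.L γ b₀ p₀ j / 4) → PlaqSmall (θBal F.L γ b₀ p₀ j / 4) U₂ →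
      (∀ s e, e ≠ B' → X s e = U₂ e) → (∀ s, X s B' = U₂ B' * expPt (s • m')) → ∀ (z : Z), ∀ x ∈ Set.Ioo (-1 : ℝ) 2, ∀ y ∈ Set.Ioo (-1 : ℝ) 2,
        (∀ r ∈ Set.uIoo x y, ∀ (n : ℕ) (hjn : j + 1 ≤ n) (hnK : n ≤ Ts), PlaqSmall (24 / 25 * θBal F.L γ b₀ p₀ n) (descendTo F ℰp n Ts hnK (Φ (X r, z)))) →
        LipschitzOnWith (Real.toNNReal ((Cc * Kχ + Cχ * Kc) * (Real.sqrt 3 * (rc * (θBal F.L γ b₀ p₀ j / 4))))) (fun s => (J (X s, z) : ℝ)) (Set.Ioo (-1 : ℝ) 2 ∩ Set.uIcc x y) := by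
  intro B' m' U₂ X hm' hU₂ hoff hon z x hx y hy hgood
  have h8 := guard8_of_guard16 hrc hθj.le hguard
  have hVs : ∀ σ ∈ Set.Ioo (-1:ℝ) 2, PlaqSmall (θBal F.L γ b₀ p₀ j) (X σ) :=
    fun σ hσ => plaqSmall_mono h8 (plaqSmall_relPath_of_le hU₂ hm' hoff hon (abs_le_two_of_mem_Ioo hσ))
  have hL0 : 0 ≤ (Cc * Kχ + Cχ * Kc) * (Real.sqrt 3 * (rc * (θBal F.L γ b₀ p₀ j / 4))) := by positivity
  refine lipschitzOnWith_of_local ((convex_Ioo _ _).inter (convex_uIcc _ _)) δ (⌈3 / δ⌉₊ + 1) (Nat.succ_pos _)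
    (fun a ha b hb => abs_sub_le_ceil_mul hδpos ha.1 hb.1) fun s hs s' hs' hδ => ?_
  rw [Real.coe_toNNReal _ hL0]
  by_cases hss : s = s'
  · subst hss; simp
  obtain ⟨-, -, hu, hupd⟩ := relPath_step B' m' U₂ X hoff hon s s'
  have hXs' : X s' = update (X s) B' (X s B' * expPt ((s' - s) • m')) := by
    have h := hupd 1; rw [one_smul, one_mul, add_sub_cancel] at h; exact h.symm
  have hV := hVs s hs.1
  have hV' := hVs s' hs'.1
  rw [hXs'] at hV'
  have hnu : ‖(s' - s) • m'‖ ≤ Real.sqrt 3 * (rc * (θBal F.L γ b₀ p₀ j / 4)) * |s - s'| := by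
    calc ‖(s' - s) • m'‖ ≤ Real.sqrt 3 * (|s' - s| * ‖m'‖) := hu
      _ ≤ Real.sqrt 3 * (|s' - s| * (rc * (θBal F.L γ b₀ p₀ j / 4))) :=
          mul_le_mul_of_nonneg_left (mul_le_mul_of_nonneg_left hm' (abs_nonneg _)) (Real.sqrt_nonneg 3)
      _ = Real.sqrt 3 * (rc * (θBal F.L γ b₀ p₀ j / 4)) * |s - s'| := by rw [abs_sub_comm]; ring
  have hδ' : ‖(s' - s) • m'‖ ≤ δ₀ := by
    refine hnu.trans (le_trans ?_ hδ₀)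
    have hθ4 : 0 ≤ Real.sqrt 3 * (rc * (θBal F.L γ b₀ p₀ j / 4)) := by positivity
    calc Real.sqrt 3 * (rc * (θBal F.L γ b₀ p₀ j / 4)) * |s - s'| ≤ Real.sqrt 3 * (rc * (θBal F.L γ b₀ p₀ j / 4)) * δ := mul_le_mul_of_nonneg_left hδ hθ4
      _ = Real.sqrt 3 * (δ * (rc * (θBal F.L γ b₀ p₀ j / 4))) := by ring
  have hseg : ∀ r ∈ Set.Ioo (0:ℝ) 1, ∀ (n : ℕ) (hjn : j + 1 ≤ n) (hnK : n ≤ Ts), PlaqSmall (24 / 25 * θBal F.L γ b₀ p₀ n) (descendTo F ℰp n Ts hnK (Φ (update (X s) B' (X s B' * expPt (r • ((s' - s) • m'))), z))) := by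
    intro r hr; rw [hupd r]; exact hgood _ (mem_uIoo_of_between hs.2 hs'.2 hss hr)
  have hc := hcLip (X s) B' ((s' - s) • m') hV hV' hδ'
  have hk := hχLip z (X s) B' ((s' - s) • m') hV hV' hδ' hseg
  have hcb := hcbdd _ hV'
  have hkb := hχbdd (X s) z hV
  rw [abs_sub_comm, hJfac, hJfac, hXs']
  calc |cJ (update (X s) B' (X s B' * expPt ((s' - s) • m'))) * χ (update (X s) B' (X s B' * expPt ((s' - s) • m'))) z - cJ (X s) * χ (X s) z|
      ≤ |cJ (update (X s) B' (X s B' * expPt ((s' - s) • m')))| * |χ (update (X s) B' (X s B' * expPt ((s' - s) • m'))) z - χ (X s) z|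
          + |χ (X s) z| * |cJ (update (X s) B' (X s B' * expPt ((s' - s) • m'))) - cJ (X s)| := abs_mul_sub_mul_le' _ _ _ _
    _ ≤ Cc * (Kχ * ‖(s' - s) • m'‖) + Cχ * (Kc * ‖(s' - s) • m'‖) :=
        add_le_add (mul_le_mul hcb hk (abs_nonneg _) hCc) (mul_le_mul hkb hc (abs_nonneg _) hCχ)
    _ = (Cc * Kχ + Cχ * Kc) * ‖(s' - s) • m'‖ := by ring
    _ ≤ (Cc * Kχ + Cχ * Kc) * (Real.sqrt 3 * (rc * (θBal F.L γ b₀ p₀ j / 4)) * |s - s'|) := mul_le_mul_of_nonneg_left hnu (by positivity)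
    _ = (Cc * Kχ + Cχ * Kc) * (Real.sqrt 3 * (rc * (θBal F.L γ b₀ p₀ j / 4))) * |s - s'| := by ring

/-- ★★ **THE SAME ALONG THE ROWS OF NEAR RELATIONAL SQUARES** — the `hSJ` binder text VERBATIM, same `KJ`. [folklore] -/
theorem jLipSquare_of_factors (F : T3Family) (γ b₀ p₀ : ℝ) (j Ts : ℕ) {Z : Type}
    (Φ : GaugeField (F.P j) 0 ↥(Matrix.specialUnitaryGroup (Fin 2) ℂ) × Z → GaugeField (F.P Ts) 0 ↥(Matrix.specialUnitaryGroup (Fin 2) ℂ)) (J : GaugeField (F.P j) 0 ↥(Matrix.specialUnitaryGroup (Fin 2) ℂ) × Z → ℝ≥0) (cJ : GaugeField (F.P j) 0 ↥(Matrix.specialUnitaryGroup (Fin 2) ℂ) → ℝ) (χ : GaugeField (F.P j) 0 ↥(Matrix.specialUnitaryGroup (Fin 2) ℂ) → Z → ℝ)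
    (hJfac : ∀ V z, (J (V, z) : ℝ) = cJ V * χ V z)
    (rc δ δ₀ : ℝ) (hrc : 0 ≤ rc) (hδpos : 0 < δ) (hθj : 0 < θBal F.L γ b₀ p₀ j) (hguard : (1 + 16 * Real.sqrt 3 * rc) * (θBal F.L γ b₀ p₀ j / 4) ≤ θBal F.L γ b₀ p₀ j)
    (hδ₀ : Real.sqrt 3 * (δ * (rc * (θBal F.L γ b₀ p₀ j / 4))) ≤ δ₀)
    (Cc Kc Cχ Kχ : ℝ) (hCc : 0 ≤ Cc) (hKc : 0 ≤ Kc) (hCχ : 0 ≤ Cχ) (hKχ : 0 ≤ Kχ)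
    -- (cJ-bdd∕Lip): the z-FREE factor (cancels in every normalised weight; typed only because the organ's `J` contains it)
    (hcbdd : ∀ V : GaugeField (F.P j) 0 ↥(Matrix.specialUnitaryGroup (Fin 2) ℂ), PlaqSmall (θBal F.L γ b₀ p₀ j) V → |cJ V| ≤ Cc)
    (hcLip : ∀ (V : GaugeField (F.P j) 0 ↥(Matrix.specialUnitaryGroup (Fin 2) ℂ)) (b : PBond (F.P j) 0) (u : Fin 3 → ℝ), PlaqSmall (θBal F.L γ b₀ p₀ j) V →
      PlaqSmall (θBal F.L γ b₀ p₀ j) (update V b (V b * expPt u)) → ‖u‖ ≤ δ₀ → |cJ (update V b (V b * expPt u)) - cJ V| ≤ Kc * ‖u‖)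
    -- (χ-bdd∕Lip∣MW): the factor that does NOT cancel — THE ONLY J-LETTER WITH CONTENT
    (hχbdd : ∀ (V : GaugeField (F.P j) 0 ↥(Matrix.specialUnitaryGroup (Fin 2) ℂ)) (z : Z), PlaqSmall (θBal F.L γ b₀ p₀ j) V → |χ V z| ≤ Cχ)
    (hχLip : ∀ (z : Z) (V : GaugeField (F.P j) 0 ↥(Matrix.specialUnitaryGroup (Fin 2) ℂ)) (b : PBond (F.P j) 0) (u : Fin 3 → ℝ), PlaqSmall (θBal F.L γ b₀ p₀ j) V →
      PlaqSmall (θBal F.L γ b₀ p₀ j) (update V b (V b * expPt u)) → ‖u‖ ≤ δ₀ →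
      (∀ r ∈ Set.Ioo (0:ℝ) 1, ∀ (n : ℕ) (hjn : j + 1 ≤ n) (hnK : n ≤ Ts), PlaqSmall (24 / 25 * θBal F.L γ b₀ p₀ n) (descendTo F ℰp n Ts hnK (Φ (update V b (V b * expPt (r • u)), z)))) →
      |χ (update V b (V b * expPt u)) z - χ V z| ≤ Kχ * ‖u‖) :
    ∀ (B B' : PBond (F.P j) 0) (m m' : Fin 3 → ℝ) (V00 : GaugeField (F.P j) 0 ↥(Matrix.specialUnitaryGroup (Fin 2) ℂ))
      (Y : ℝ → GaugeField (F.P j) 0 ↥(Matrix.specialUnitaryGroup (Fin 2) ℂ)) (X : ℝ → ℝ → GaugeField (F.P j) 0 ↥(Matrix.specialUnitaryGroup (Fin 2) ℂ)),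
      ‖m‖ ≤ rc * (θBal F.L γ b₀ p₀ j / 4) → ‖m'‖ ≤ rc * (θBal F.L γ b₀ p₀ j / 4) → PlaqSmall (θBal F.L γ b₀ p₀ j / 4) V00 →
      (∀ s e, e ≠ B → Y s e = V00 e) → (∀ s, Y s B = V00 B * expPt (s • m)) → (∀ s s' e, e ≠ B' → X s s' e = Y s e) → (∀ s s', X s s' B' = Y s B' * expPt (s' • m')) →
      ∀ s' ∈ Set.Icc (0:ℝ) 1, ∀ (z : Z), ∀ x ∈ Set.Ioo (-1 : ℝ) 2, ∀ y ∈ Set.Ioo (-1 : ℝ) 2,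
        (∀ r ∈ Set.uIoo x y, ∀ (n : ℕ) (hjn : j + 1 ≤ n) (hnK : n ≤ Ts), PlaqSmall (24 / 25 * θBal F.L γ b₀ p₀ n) (descendTo F ℰp n Ts hnK (Φ (X r s', z)))) →
        LipschitzOnWith (Real.toNNReal ((Cc * Kχ + Cχ * Kc) * (Real.sqrt 3 * (rc * (θBal F.L γ b₀ p₀ j / 4))))) (fun s => (J (X s s', z) : ℝ)) (Set.Ioo (-1 : ℝ) 2 ∩ Set.uIcc x y) := by
  intro B B' m m' V00 Y X hm hm' hV00 hYoff hYon hXoff hXon s' hs' z x hx y hy hgood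
  have hVs : ∀ σ ∈ Set.Ioo (-1:ℝ) 2, PlaqSmall (θBal F.L γ b₀ p₀ j) (X σ s') :=
    fun σ hσ => plaqSmall_mono hguard (plaqSmall_relSquare_of_le hV00 hm hm' hYoff hYon hXoff hXon (abs_le_two_of_mem_Ioo hσ) (abs_le_two_of_mem_Icc hs'))
  have hL0 : 0 ≤ (Cc * Kχ + Cχ * Kc) * (Real.sqrt 3 * (rc * (θBal F.L γ b₀ p₀ j / 4))) := by positivity
  refine lipschitzOnWith_of_local ((convex_Ioo _ _).inter (convex_uIcc _ _)) δ (⌈3 / δ⌉₊ + 1) (Nat.succ_pos _)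
    (fun a ha b hb => abs_sub_le_ceil_mul hδpos ha.1 hb.1) fun s hs s'' hs'' hδ => ?_
  rw [Real.coe_toNNReal _ hL0]
  by_cases hss : s = s''
  · subst hss; simp
  obtain ⟨u, -, -, hu, hupd⟩ := relSquare_row_step B B' m m' V00 Y X hYoff hYon hXoff hXon s s'' s'
  have hXs' : X s'' s' = update (X s s') B (X s s' B * expPt u) := by
    have h := hupd 1; rw [one_smul, one_mul, add_sub_cancel] at h; exact h.symm
  have hV := hVs s hs.1
  have hV' := hVs s'' hs''.1
  rw [hXs'] at hV'
  have hnu : ‖u‖ ≤ Real.sqrt 3 * (rc * (θBal F.L γ b₀ p₀ j / 4)) * |s - s''| := by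
    calc ‖u‖ ≤ Real.sqrt 3 * (|s'' - s| * ‖m‖) := hu
      _ ≤ Real.sqrt 3 * (|s'' - s| * (rc * (θBal F.L γ b₀ p₀ j / 4))) :=
          mul_le_mul_of_nonneg_left (mul_le_mul_of_nonneg_left hm (abs_nonneg _)) (Real.sqrt_nonneg 3)
      _ = Real.sqrt 3 * (rc * (θBal F.L γ b₀ p₀ j / 4)) * |s - s''| := by rw [abs_sub_comm]; ring
  have hδ' : ‖u‖ ≤ δ₀ := by
    refine hnu.trans (le_trans ?_ hδ₀)
    have hθ4 : 0 ≤ Real.sqrt 3 * (rc * (θBal F.L γ b₀ p₀ j / 4)) := by positivity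
    calc Real.sqrt 3 * (rc * (θBal F.L γ b₀ p₀ j / 4)) * |s - s''| ≤ Real.sqrt 3 * (rc * (θBal F.L γ b₀ p₀ j / 4)) * δ := mul_le_mul_of_nonneg_left hδ hθ4
      _ = Real.sqrt 3 * (δ * (rc * (θBal F.L γ b₀ p₀ j / 4))) := by ring
  have hseg : ∀ r ∈ Set.Ioo (0:ℝ) 1, ∀ (n : ℕ) (hjn : j + 1 ≤ n) (hnK : n ≤ Ts), PlaqSmall (24 / 25 * θBal F.L γ b₀ p₀ n) (descendTo F ℰp n Ts hnK (Φ (update (X s s') B (X s s' B * expPt (r • u)), z))) := by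
    intro r hr; rw [hupd r]; exact hgood _ (mem_uIoo_of_between hs.2 hs''.2 hss hr)
  have hc := hcLip (X s s') B u hV hV' hδ'
  have hk := hχLip z (X s s') B u hV hV' hδ' hseg
  have hcb := hcbdd _ hV'
  have hkb := hχbdd (X s s') z hV
  rw [abs_sub_comm, hJfac, hJfac, hXs']
  calc |cJ (update (X s s') B (X s s' B * expPt u)) * χ (update (X s s') B (X s s' B * expPt u)) z - cJ (X s s') * χ (X s s') z|
      ≤ |cJ (update (X s s') B (X s s' B * expPt u))| * |χ (update (X s s') B (X s s' B * expPt u)) z - χ (X s s') z|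
          + |χ (X s s') z| * |cJ (update (X s s') B (X s s' B * expPt u)) - cJ (X s s')| := abs_mul_sub_mul_le' _ _ _ _
    _ ≤ Cc * (Kχ * ‖u‖) + Cχ * (Kc * ‖u‖) :=
        add_le_add (mul_le_mul hcb hk (abs_nonneg _) hCc) (mul_le_mul hkb hc (abs_nonneg _) hCχ)
    _ = (Cc * Kχ + Cχ * Kc) * ‖u‖ := by ring
    _ ≤ (Cc * Kχ + Cχ * Kc) * (Real.sqrt 3 * (rc * (θBal F.L γ b₀ p₀ j / 4)) * |s - s''|) := mul_le_mul_of_nonneg_left hnu (by positivity)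
    _ = (Cc * Kχ + Cχ * Kc) * (Real.sqrt 3 * (rc * (θBal F.L γ b₀ p₀ j / 4))) * |s - s''| := by ring

end Jacobian

end Summit.QuantumFields.YangMills.Theorems.OrganTangentD0ChartLettersWhitened

end
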